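/-
Copyright (c) 2026. All rights reserved.
Released under Apache 2.0 license as described in the file LICENSE.
Authors: abc-iut cell, prover seat abc-iut-c312-5 (Cor. 3.12 sub-crew, gen 7).
-/
import Literature.IUT.LogVolume.TensorPacketLicenceExact
import Literature.IUT.LogVolume.TensorPacketFactorwiseOrbitSpan
import HarnessLib

/-!
# The per-summand (xi-f) inclusion for the FACTORWISE (Ind2) of [IUTchIII] Thm. 3.11 (i): the same exact criterion

abc-iut cell, seat abc-iut-c312-5 (D-0079 sub-cell R-W, lane U, task T2 «T2-EXACT-CONTENT»; corollary sheet of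
`TensorPacketLicenceExact.lean` for the consumer «U2-LICENCE-WRAPPER» at the real settings, whose typed (Ind2) acts
FACTORWISE — `⊗_i g_i` with `g_i ∈ Aut_{ℚ_p}(k_i : log_p(R_i^×))`, [IUTchIII] Thm. 3.11 (i) «independent copies of Ism on
each factor», read through a `p`-adic presentation).  PROOF-ONLY file (no definitions, no named `Prop` facts).

* **`iota_smul_subset_packetHull_factorwiseOrbit_iota_smul_iff`** — with the largest inner balls `c^in_i·R_i ⊆ log_p(R_i^×)`
  (`ρ_in = ‖c^in_i‖`) and elements `c^out_i ∈ log_p(R_i^×)` of largest norm (`ρ_out = ‖c^out_i‖`), a Θ-box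
  `M_Θ = ι_b(t_Θ)·(R_I)^∼` (`t_Θ ≠ 0`) and a q-box `M_q = ι_{b'}(t_q)·(R_I)^∼`:
  `M_q ⊆ hull(⋃_{g factorwise} (⊗g_i)(M_Θ)) ⟺ ∀ m, (∀ J, p^m·‖t_Θ‖ ≤ p^{−(d_I − d_{L_J})}·∏ρ_in) → p^m·‖t_q‖ ≤ ∏ρ_out`
  — abc-iut-w5-d180's `packetHull_factorwiseOrbit_eq_zpow` (the factorwise orbit of a region of content `m` has hull
  `hull(p^m·log_p(R_I^×))`, like the full `Aut_{ℚ_p}(V : log_p(R_I^×))`-orbit) and part 3's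
  `iota_smul_subset_packetHull_orbit_iota_smul_iff`.

HONEST SCOPE as in parts 1–3: lattice algebra over the cell's typed containers and typed (Ind2); the per-summand hull
inclusion is a STRONGER-THAN-PRINT reading of [IUTchIII] Cor. 3.12 Step (xi-f); nothing here bears on the printed GLOBAL
inequality; no side taken on [IUTchIII] Cor. 3.12. [cite: Mochizuki2012, IUTchIII Thm. 3.11 (i) (Ind2) p. 154; IUTchIV Prop. 1.1 p. 9]
[cite: DupuyHilado2025, §4.9, §4.12] [cite: WeilBNT1967, Ch. II §2, Th. 1–2] [claim: Mochizuki2012, status: disputed].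
-/

noncomputable section

open Set Module Function
open scoped Pointwise TensorProduct NormedField nonZeroDivisors

namespace Literature.IUT.LogVolume

open Literature.NumberTheory.GaloisRepresentations.Ultrametric

variable (p : ℕ) [Fact p.Prime]
variable {I : Type} [Fintype I] [DecidableEq I] [Nonempty I]
variable (k : I → Type) [∀ i, NontriviallyNormedField (k i)] [∀ i, NormedAlgebra ℚ_[p] (k i)]
  [∀ i, IsUltrametricDist (k i)] [∀ i, ProperSpace (k i)]

/-- **THE PER-SUMMAND LICENCE CELL for the factorwise (Ind2).**  Same statement as
`iota_smul_subset_packetHull_orbit_iota_smul_iff` with the orbit under the factorwise families `⊗_i g_i`,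
`g_i(log_p(R_i^×)) = log_p(R_i^×)`, in place of the full lattice-automorphism group: the two orbits of the Θ-box have
the same hull (abc-iut-w5-d180). [cite: DupuyHilado2025, §4.9, §4.12] [cite: Mochizuki2012, IUTchIII Thm. 3.11 (i) (Ind2) p. 154] -/
theorem iota_smul_subset_packetHull_factorwiseOrbit_iota_smul_iff {cin cout : Π i, k i} (hin0 : ∀ i, cin i ≠ 0)
    (hin : ∀ i (o : k i), ‖o‖ ≤ 1 → cin i * o ∈ logUnits (k i))
    (hmax : ∀ i, ∃ (ϖ : (k i)ˣ) (w : k i), IsUniformizer ϖ ∧ w ∉ logUnits (k i) ∧ ‖w‖ * ‖(ϖ : k i)‖ ≤ ‖cin i‖)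
    (hout0 : ∀ i, cout i ≠ 0) (houtΛ : ∀ i, cout i ∈ logUnits (k i))
    (hdom : ∀ i, ∀ z ∈ logUnits (k i), ‖z‖ ≤ ‖cout i‖)
    (b b' : I) {tΘ : k b} (htΘ : tΘ ≠ 0) (tq : k b') :
    iota p k b' tq • (normalizedPacket p k : Set (PacketAlgebra p k)) ⊆
        packetHull p k (⋃ g ∈ {g : ∀ i, k i ≃ₗ[ℚ_[p]] k i | ∀ i, g i '' logUnits (k i) = logUnits (k i)},
          (PiTensorProduct.congr g : PacketAlgebra p k ≃ₗ[ℚ_[p]] PacketAlgebra p k) ''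
            (iota p k b tΘ • (normalizedPacket p k : Set (PacketAlgebra p k)))) ↔
      ∀ m : ℤ, (∀ J, (p : ℝ) ^ m * ‖tΘ‖ ≤ (p : ℝ) ^ (-(dSum p k - differentOrd p (DFac p k J))) * ∏ i, ‖cin i‖) →
        (p : ℝ) ^ m * ‖tq‖ ≤ ∏ i, ‖cout i‖ := by
  set M : Set (PacketAlgebra p k) := iota p k b tΘ • (normalizedPacket p k : Set (PacketAlgebra p k)) with hM
  have hMb : IsPsiBounded p k M := isPsiBounded_smul_normalizedPacket p k _
  have hM0 : ∃ x ∈ M, x ≠ 0 := by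
    refine ⟨iota p k b tΘ, ⟨1, (normalizedPacket p k).one_mem, by
      change iota p k b tΘ • (1 : PacketAlgebra p k) = _; rw [smul_eq_mul, mul_one]⟩, fun h0 => ?_⟩
    obtain ⟨J⟩ := (inferInstance : Nonempty (DIdx p k))
    exact dEquiv_iota_ne_zero p k b htΘ J (by rw [h0, map_zero, Pi.zero_apply])
  obtain ⟨m₀, hm₀, hm₀1⟩ := exists_content p k hMb hM0
  obtain ⟨x, hxM, hx⟩ := Set.not_subset.mp hm₀1
  rw [packetHull_factorwiseOrbit_eq_zpow p k hxM hx hm₀, ← packetHull_orbit_eq_zpow p k hxM hx hm₀]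
  exact iota_smul_subset_packetHull_orbit_iota_smul_iff p k hin0 hin hmax hout0 houtΛ hdom b b' htΘ tq

end Literature.IUT.LogVolume

end
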